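import Summits.CriticalPhenomena.PercolationContinuityZ3.Theorems.PercNearOneGluingNoHeavyLowerTailSahiOneStepOppositeShifted
import Summits.CriticalPhenomena.PercolationContinuityZ3.Theorems.PercNearOneGluingNoHeavyLowerTailSahiOneStepFuzzyReduce
import Summits.CriticalPhenomena.PercolationContinuityZ3.Theorems.PercNearOneGluingNoHeavyLowerTailSahiOneStepFuzzyCompression
import Summits.CriticalPhenomena.PercolationContinuityZ3.Theorems.PercNearOneGluingNoHeavyLowerTailSahiOneStepUniformShiftMeasure
import Summits.CriticalPhenomena.PercolationContinuityZ3.Theorems.PercNearOneGluingNoHeavyLowerTailSahiOneStepDensityClosure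
import Summits.CriticalPhenomena.PercolationContinuityZ3.Theorems.PercNearOneGluingNoHeavyLowerTailSahiOneStepWeightedMajority
import Literature.Probability.LatticeModels.ProdBernoulliIndependence
import HarnessLib

/-!
# THEOREM SP: the `(2′)` half (hence Kahn C5 / Sahi `C₃` in a threshold slot) for an ARBITRARY increasing event against a SHIFTED one,
# at EVERY density vector `p ∈ [0,1]^ι`

Support file (prover prim-ineq-prove-3 gen 30, re-landed gen 53 after a dedup bounce; `--supports stmt-CriticalPhenomena-4575`; memo
`run/shared/lean/prim/prim-ineq-prove-3/PROOF-G30-SHIFTED-PARTNER.md`).  No definitions, no named facts, no sorries, no `native_decide`.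

For `p ∈ [0,1]^ι`, a block `F` ranked by `σ` (injective on `F`), `t : ℕ`, `H = Th_t(F) = {ω | t ≤ #(F ∩ ω)}`, and increasing `F`-determined
events `A` (ARBITRARY) and `B` RIGHT-SHIFTED w.r.t. `σ` (`ω ∈ B`, `x ∈ ω ∌ y`, `σ x < σ y` ⟹ `ω − x + y ∈ B`; e.g. every weighted majority
with weights increasing along `σ`, every principal up-set of a terminal segment, …):
`osN_threshold_nonneg_of_rightShiftedPartner : 0 ≤ N_t(1_A, 1_B)`, i.e. `Cov(1_A,1_B) ≥ μ(N_F<t)·Cov(1_A,1_B ∣ N_F<t)`, and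
`sahiE3_threshold_nonneg_of_rightShiftedPartner : 0 ≤ E₃(1_{Th_t(F)}, 1_A, 1_B)`; the mirror images (`A` shifted, `B` arbitrary;
left-shifted partners) by `osN_comm` and rank reversal; THEOREM S′ at every density (`osN_threshold_nonneg_of_oppositeShifted_all`).
The proofs run at INTERIOR densities (`…_interior`) and pass to the closed cube by continuity (`osN_nonneg_of_forall_interior`, `…DensityClosure`).
**Harris-trivial pairs** (`osN_nonneg_of_inter_subset`: `A ∩ B ⊆ H`) and **sandwich pairs** (`osN_threshold_nonneg_of_shiftedSandwich`): if some right-shifted up-set `V` satisfies `B ⊆ V` and `V ∩ A ∩ H ⊆ B`, then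
`N_t(1_A,1_B) ≥ N_t(1_A,1_V) ≥ 0` for every `p` (second-argument monotonicity of `N_t` + SP) — with SP and the Harris-trivial case this certifies
ALL pairs of up-sets on 4 coordinates and all but 0.14 % of sampled pairs on 5 (memo §9).
Headline corollary: **`sahiE3_threshold_any_weightedMajority_nonneg`** — Kahn C5 / Sahi `C₃` with a Hamming-threshold first slot for ANY increasing
`F`-determined event against ANY weighted-majority game on `F` (nonnegative weights, any quota), every product measure.

Proof (three landed ingredients): the FUZZY COMPRESSION LEMMA (`exists_leftShifted_surrogate`, `…FuzzyCompression`) produces an increasing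
`F`-determined `[0,1]`-valued LEFT-SHIFTED `φ` with the `H`-mass and total mass of `1_A` and no larger `H ∩ B`-overlap; the surrogate
reduction (`osN_nonneg_of_leftShifted_surrogate`, `…FuzzyReduce`) gives `N_t(1_A,1_B) ≥ N_t(φ,1_B) ≥ 0` once `N_t(1_U,1_B) ≥ 0` for every
left-shifted up-set `U` — which is THEOREM S′ (`osN_threshold_nonneg_of_oppositeShifted`, `…OppositeShifted`).
-/

noncomputable section

namespace Summit.CriticalPhenomena.PercolationContinuityZ3.Theorems

namespace SahiOneStep

open MeasureTheory Finset
open Literature.Probability.Percolation (DeterminedBy determinedBy_iff)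
open Literature.Probability.LatticeModels (prodBernoulli sahiE3 prodBernoulli_harris)
open Literature.Probability.Percolation.DecisionTree (ind ind_of_mem ind_of_not_mem ind_nonneg)
open scoped Classical

variable {ι : Type*} [Fintype ι]

omit [Fintype ι] in
/-- An indicator is `[0,1]`-valued. [folklore] -/
theorem ind_mem_Icc (A : Set (Set ι)) (ω : Set ι) : 0 ≤ ind A ω ∧ ind A ω ≤ 1 := by
  by_cases hω : ω ∈ A
  · rw [ind_of_mem hω]; exact ⟨zero_le_one, le_rfl⟩
  · rw [ind_of_not_mem hω]; exact ⟨le_rfl, zero_le_one⟩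

omit [Fintype ι] in
/-- The indicator of an `F`-determined event depends only on `ω ∩ F`. [folklore] -/
theorem ind_eq_ind_inter_of_determinedBy {A : Set (Set ι)} {F : Finset ι} (hAF : DeterminedBy A (↑F : Set ι)) (ω : Set ι) :
    ind A ω = ind A (ω ∩ (F : Set ι)) := by
  have h := (determinedBy_iff A (F : Set ι)).1 hAF ω (ω ∩ (F : Set ι)) (by rw [Set.inter_assoc, Set.inter_self])
  by_cases hω : ω ∈ A
  · rw [ind_of_mem hω, ind_of_mem (h.1 hω)]
  · rw [ind_of_not_mem hω, ind_of_not_mem (fun h' => hω (h.2 h'))]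

omit [Fintype ι] in
/-- `Th_t(F)` is invariant under trades inside `F`. [folklore] -/
theorem threshold_trade_iff (F : Finset ι) (t : ℕ) (ω : Set ι) {x y : ι} (hx : x ∈ F) (hy : y ∈ F) (hxω : x ∈ ω) (hyω : y ∉ ω) :
    ω ∈ {ω : Set ι | t ≤ (F.filter (· ∈ ω)).card} ↔ (ω \ {x}) ∪ {y} ∈ {ω : Set ι | t ≤ (F.filter (· ∈ ω)).card} := by
  have h : (F.filter (· ∈ (ω \ {x}) ∪ {y})).card = (F.filter (· ∈ ω)).card := card_filter_trade hx hy hxω hyω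
  simp only [Set.mem_setOf_eq]
  -- (the two filters differ only in their `DecidablePred` instances)
  constructor
  · intro h1; refine h1.trans (le_of_eq ?_); convert h.symm using 3
  · intro h1; refine h1.trans (le_of_eq ?_); convert h using 3

/-- **THEOREM S′ at every density**: `0 ≤ N_t(1_A, 1_B)` for `A` left-, `B` right-shifted w.r.t. an injective ranking of `F`, every `p ∈ [0,1]^ι`
(the interior statement `osN_threshold_nonneg_of_oppositeShifted` + continuity in `p`). [this work] -/
theorem osN_threshold_nonneg_of_oppositeShifted_all (p : ι → unitInterval) (σ : ι → ℕ) (F : Finset ι) (hσ : Set.InjOn σ (↑F : Set ι))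
    (t : ℕ) {A B : Set (Set ι)} (hA : IsUpperSet A) (hB : IsUpperSet B)
    (hAF : DeterminedBy A (↑F : Set ι)) (hBF : DeterminedBy B (↑F : Set ι))
    (hAs : ∀ ω ∈ A, ∀ x ∈ F, ∀ y ∈ F, σ y < σ x → x ∈ ω → y ∉ ω → (ω \ {x}) ∪ {y} ∈ A)
    (hBs : ∀ ω ∈ B, ∀ x ∈ F, ∀ y ∈ F, σ x < σ y → x ∈ ω → y ∉ ω → (ω \ {x}) ∪ {y} ∈ B) :
    0 ≤ osN p {ω : Set ι | t ≤ (F.filter (· ∈ ω)).card} (ind A) (ind B) :=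
  osN_nonneg_of_forall_interior _ _ _
    (fun q hq => osN_threshold_nonneg_of_oppositeShifted q σ F hσ (fun i _ => hq i) t hA hB hAF hBF hAs hBs) p

/-- **THEOREM SP at an interior density (`(2′)` half, right-shifted partner).**  For `p ∈ (0,1)^ι`, `A` ANY increasing `F`-determined event and
`B` an increasing `F`-determined event right-shifted w.r.t. an injective ranking `σ` of `F`:  `0 ≤ N_t(1_A, 1_B)`. [this work] -/
theorem osN_threshold_nonneg_of_rightShiftedPartner_interior (p : ι → unitInterval) (hp : ∀ e, 0 < (p e : ℝ) ∧ (p e : ℝ) < 1)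
    (σ : ι → ℕ) (F : Finset ι) (hσ : Set.InjOn σ (↑F : Set ι)) (t : ℕ) {A B : Set (Set ι)} (hA : IsUpperSet A) (hB : IsUpperSet B)
    (hAF : DeterminedBy A (↑F : Set ι)) (hBF : DeterminedBy B (↑F : Set ι))
    (hBs : ∀ ω ∈ B, ∀ x ∈ F, ∀ y ∈ F, σ x < σ y → x ∈ ω → y ∉ ω → (ω \ {x}) ∪ {y} ∈ B) :
    0 ≤ osN p {ω : Set ι | t ≤ (F.filter (· ∈ ω)).card} (ind A) (ind B) := by
  have hp' : ∀ i ∈ F, 0 < (p i : ℝ) ∧ (p i : ℝ) < 1 := fun i _ => hp i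
  obtain ⟨φ, hφm, hφb, hφF, hφs, hφH, hφ1, hφB⟩ :=
    exists_leftShifted_surrogate p hp F σ (H := {ω : Set ι | t ≤ (F.filter (· ∈ ω)).card}) (B := B)
      (fun ω x hx y hy hxω hyω => threshold_trade_iff F t ω hx hy hxω hyω)
      (fun ω x hx y hy hxy hxω hyω hωB => hBs ω hωB x hx y hy hxy hxω hyω)
      (ind A) (Literature.Combinatorics.Sahi2008.monotone_ind_of_isUpperSet hA) (ind_mem_Icc A) (ind_eq_ind_inter_of_determinedBy hAF)
  exact osN_nonneg_of_leftShifted_surrogate p {ω : Set ι | t ≤ (F.filter (· ∈ ω)).card} F σ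
    (fun U hU hUF hUs => osN_threshold_nonneg_of_oppositeShifted p σ F hσ hp' t hU hB hUF hBF hUs hBs)
    φ hφm (fun ω => (hφb ω).1) hφF hφs hφH hφ1 hφB

/-- **THEOREM SP (`(2′)` half, right-shifted partner, EVERY density `p ∈ [0,1]^ι`).**  `A` ANY increasing `F`-determined event, `B` increasing
`F`-determined and right-shifted w.r.t. an injective ranking `σ` of `F`:  `0 ≤ N_t(1_A, 1_B)`, i.e. `Cov(1_A,1_B) ≥ μ(N_F < t)·Cov(1_A, 1_B ∣ N_F < t)`. [this work] -/
theorem osN_threshold_nonneg_of_rightShiftedPartner (p : ι → unitInterval)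
    (σ : ι → ℕ) (F : Finset ι) (hσ : Set.InjOn σ (↑F : Set ι)) (t : ℕ) {A B : Set (Set ι)} (hA : IsUpperSet A) (hB : IsUpperSet B)
    (hAF : DeterminedBy A (↑F : Set ι)) (hBF : DeterminedBy B (↑F : Set ι))
    (hBs : ∀ ω ∈ B, ∀ x ∈ F, ∀ y ∈ F, σ x < σ y → x ∈ ω → y ∉ ω → (ω \ {x}) ∪ {y} ∈ B) :
    0 ≤ osN p {ω : Set ι | t ≤ (F.filter (· ∈ ω)).card} (ind A) (ind B) :=
  osN_nonneg_of_forall_interior _ _ _ (fun q hq => osN_threshold_nonneg_of_rightShiftedPartner_interior q hq σ F hσ t hA hB hAF hBF hBs) p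

/-- **THEOREM SP, mirror image** (`A` right-shifted, `B` arbitrary), by the symmetry of `N_t`. [this work] -/
theorem osN_threshold_nonneg_of_rightShifted_left (p : ι → unitInterval)
    (σ : ι → ℕ) (F : Finset ι) (hσ : Set.InjOn σ (↑F : Set ι)) (t : ℕ) {A B : Set (Set ι)} (hA : IsUpperSet A) (hB : IsUpperSet B)
    (hAF : DeterminedBy A (↑F : Set ι)) (hBF : DeterminedBy B (↑F : Set ι))
    (hAs : ∀ ω ∈ A, ∀ x ∈ F, ∀ y ∈ F, σ x < σ y → x ∈ ω → y ∉ ω → (ω \ {x}) ∪ {y} ∈ A) :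
    0 ≤ osN p {ω : Set ι | t ≤ (F.filter (· ∈ ω)).card} (ind A) (ind B) := by
  rw [osN_comm]
  exact osN_threshold_nonneg_of_rightShiftedPartner p σ F hσ t hB hA hBF hAF hAs

/-- **THEOREM SP, left-shifted partner** (`A` arbitrary, `B` LEFT-shifted w.r.t. `σ`: `σ y < σ x`, `x ∈ ω ∌ y`, `ω ∈ B` ⟹ `ω − x + y ∈ B`),
by reversing the ranking. [this work] -/
theorem osN_threshold_nonneg_of_leftShiftedPartner (p : ι → unitInterval)
    (σ : ι → ℕ) (F : Finset ι) (hσ : Set.InjOn σ (↑F : Set ι)) (t : ℕ) {A B : Set (Set ι)} (hA : IsUpperSet A) (hB : IsUpperSet B)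
    (hAF : DeterminedBy A (↑F : Set ι)) (hBF : DeterminedBy B (↑F : Set ι))
    (hBs : ∀ ω ∈ B, ∀ x ∈ F, ∀ y ∈ F, σ y < σ x → x ∈ ω → y ∉ ω → (ω \ {x}) ∪ {y} ∈ B) :
    0 ≤ osN p {ω : Set ι | t ≤ (F.filter (· ∈ ω)).card} (ind A) (ind B) := by
  -- reversed ranking `σ' i = sup σ − σ i`
  set K := F.sup σ with hK
  have hle : ∀ i ∈ F, σ i ≤ K := fun i hi => Finset.le_sup hi
  refine osN_threshold_nonneg_of_rightShiftedPartner p (fun i => K - σ i) F ?_ t hA hB hAF hBF ?_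
  · intro x hx y hy hxy
    have hx' := hle x hx; have hy' := hle y hy
    have h : K - σ x = K - σ y := hxy
    exact hσ hx hy (by omega)
  · intro ω hω x hx y hy hxy hxω hyω
    have hx' := hle x hx; have hy' := hle y hy
    have h : K - σ x < K - σ y := hxy
    exact hBs ω hω x hx y hy (by omega) hxω hyω

/-- **KAHN C5 / SAHI `C₃` FOR A THRESHOLD SLOT, AN ARBITRARY INCREASING EVENT AND A SHIFTED ONE, EVERY DENSITY VECTOR**:
`0 ≤ E₃(1_{Th_t(F)}, 1_A, 1_B)` for `p ∈ [0,1]^ι`, `A` any increasing `F`-determined event, `B` increasing `F`-determined and right-shifted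
w.r.t. an injective ranking of `F`. [this work] -/
theorem sahiE3_threshold_nonneg_of_rightShiftedPartner (p : ι → unitInterval)
    (σ : ι → ℕ) (F : Finset ι) (hσ : Set.InjOn σ (↑F : Set ι)) (t : ℕ) {A B : Set (Set ι)} (hA : IsUpperSet A) (hB : IsUpperSet B)
    (hAF : DeterminedBy A (↑F : Set ι)) (hBF : DeterminedBy B (↑F : Set ι))
    (hBs : ∀ ω ∈ B, ∀ x ∈ F, ∀ y ∈ F, σ x < σ y → x ∈ ω → y ∉ ω → (ω \ {x}) ∪ {y} ∈ B) :
    0 ≤ sahiE3 (prodBernoulli p) {ω : Set ι | t ≤ (F.filter (· ∈ ω)).card} A B := by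
  rw [← osT_ind_ind, osT_eq_osMp_add_osN]
  exact add_nonneg (osMp_threshold_nonneg_all p F t hA hB) (osN_threshold_nonneg_of_rightShiftedPartner p σ F hσ t hA hB hAF hBF hBs)

/-- The same with `A` right-shifted and `B` arbitrary. [this work] -/
theorem sahiE3_threshold_nonneg_of_rightShifted_left (p : ι → unitInterval)
    (σ : ι → ℕ) (F : Finset ι) (hσ : Set.InjOn σ (↑F : Set ι)) (t : ℕ) {A B : Set (Set ι)} (hA : IsUpperSet A) (hB : IsUpperSet B)
    (hAF : DeterminedBy A (↑F : Set ι)) (hBF : DeterminedBy B (↑F : Set ι))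
    (hAs : ∀ ω ∈ A, ∀ x ∈ F, ∀ y ∈ F, σ x < σ y → x ∈ ω → y ∉ ω → (ω \ {x}) ∪ {y} ∈ A) :
    0 ≤ sahiE3 (prodBernoulli p) {ω : Set ι | t ≤ (F.filter (· ∈ ω)).card} A B := by
  rw [← osT_ind_ind, osT_eq_osMp_add_osN]
  exact add_nonneg (osMp_threshold_nonneg_all p F t hA hB) (osN_threshold_nonneg_of_rightShifted_left p σ F hσ t hA hB hAF hBF hAs)

/-- The same with `A` arbitrary and `B` left-shifted. [this work] -/
theorem sahiE3_threshold_nonneg_of_leftShiftedPartner (p : ι → unitInterval)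
    (σ : ι → ℕ) (F : Finset ι) (hσ : Set.InjOn σ (↑F : Set ι)) (t : ℕ) {A B : Set (Set ι)} (hA : IsUpperSet A) (hB : IsUpperSet B)
    (hAF : DeterminedBy A (↑F : Set ι)) (hBF : DeterminedBy B (↑F : Set ι))
    (hBs : ∀ ω ∈ B, ∀ x ∈ F, ∀ y ∈ F, σ y < σ x → x ∈ ω → y ∉ ω → (ω \ {x}) ∪ {y} ∈ B) :
    0 ≤ sahiE3 (prodBernoulli p) {ω : Set ι | t ≤ (F.filter (· ∈ ω)).card} A B := by
  rw [← osT_ind_ind, osT_eq_osMp_add_osN]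
  exact add_nonneg (osMp_threshold_nonneg_all p F t hA hB) (osN_threshold_nonneg_of_leftShiftedPartner p σ F hσ t hA hB hAF hBF hBs)

/-- **THEOREM S′ (E₃ form) at every density**: `0 ≤ E₃(1_{Th_t(F)}, 1_A, 1_B)` for `A` left-, `B` right-shifted, every `p ∈ [0,1]^ι`. [this work] -/
theorem sahiE3_threshold_nonneg_of_oppositeShifted_all (p : ι → unitInterval) (σ : ι → ℕ) (F : Finset ι) (hσ : Set.InjOn σ (↑F : Set ι))
    (t : ℕ) {A B : Set (Set ι)} (hA : IsUpperSet A) (hB : IsUpperSet B)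
    (hAF : DeterminedBy A (↑F : Set ι)) (hBF : DeterminedBy B (↑F : Set ι))
    (hAs : ∀ ω ∈ A, ∀ x ∈ F, ∀ y ∈ F, σ y < σ x → x ∈ ω → y ∉ ω → (ω \ {x}) ∪ {y} ∈ A)
    (hBs : ∀ ω ∈ B, ∀ x ∈ F, ∀ y ∈ F, σ x < σ y → x ∈ ω → y ∉ ω → (ω \ {x}) ∪ {y} ∈ B) :
    0 ≤ sahiE3 (prodBernoulli p) {ω : Set ι | t ≤ (F.filter (· ∈ ω)).card} A B := by
  rw [← osT_ind_ind, osT_eq_osMp_add_osN]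
  exact add_nonneg (osMp_threshold_nonneg_all p F t hA hB) (osN_threshold_nonneg_of_oppositeShifted_all p σ F hσ t hA hB hAF hBF hAs hBs)


/-- Sorting a block by a real weight: an injective ranking `σ` of `F` along which `w` does not decrease (ties broken by an enumeration of `ι`). [folklore] -/
theorem exists_ranking_along (F : Finset ι) (w : ι → ℝ) :
    ∃ σ : ι → ℕ, Set.InjOn σ (↑F : Set ι) ∧ ∀ x ∈ F, ∀ y ∈ F, σ x < σ y → w x ≤ w y := by
  -- enumeration of `ι` and the lexicographic strict order `(w, e)`
  set e : ι → ℕ := fun x => (Fintype.equivFin ι x : ℕ) with he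
  have heinj : Function.Injective e := fun x y h => (Fintype.equivFin ι).injective (Fin.ext h)
  set lt : ι → ι → Prop := fun z x => w z < w x ∨ (w z = w x ∧ e z < e x) with hlt
  set σ : ι → ℕ := fun x => (F.filter (fun z => lt z x)).card with hσ
  have hsub : ∀ x y, lt y x → F.filter (fun z => lt z y) ⊆ F.filter (fun z => lt z x) := by
    intro x y hyx z hz
    rw [Finset.mem_filter] at hz ⊢
    refine ⟨hz.1, ?_⟩
    rcases hz.2 with h1 | ⟨h1, h2⟩
    · rcases hyx with h3 | ⟨h3, _⟩
      · exact Or.inl (h1.trans h3)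
      · exact Or.inl (h3 ▸ h1)
    · rcases hyx with h3 | ⟨h3, h4⟩
      · exact Or.inl (h1 ▸ h3)
      · exact Or.inr ⟨h1.trans h3, h2.trans h4⟩
  have hirr : ∀ x, ¬ lt x x := fun x h => by
    rcases h with h | ⟨_, h⟩
    · exact lt_irrefl _ h
    · exact lt_irrefl _ h
  have htot : ∀ x y, x ≠ y → lt x y ∨ lt y x := by
    intro x y hxy
    rcases lt_trichotomy (w x) (w y) with h | h | h
    · exact Or.inl (Or.inl h)
    · have hne : e x ≠ e y := fun h' => hxy (heinj h')
      rcases lt_or_gt_of_ne hne with h' | h'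
      · exact Or.inl (Or.inr ⟨h, h'⟩)
      · exact Or.inr (Or.inr ⟨h.symm, h'⟩)
    · exact Or.inr (Or.inl h)
  have hlt_card : ∀ x ∈ F, ∀ y, lt x y → σ x < σ y := by
    intro x hx y hxy
    apply Finset.card_lt_card
    refine ⟨hsub y x hxy, fun h => ?_⟩
    have hxmem : x ∈ F.filter (fun z => lt z y) := Finset.mem_filter.2 ⟨hx, hxy⟩
    exact hirr x (Finset.mem_filter.1 (h hxmem)).2
  refine ⟨σ, ?_, ?_⟩
  · intro x hx y hy hxy
    by_contra hne
    rcases htot x y hne with h | h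
    · exact absurd hxy (ne_of_lt (hlt_card x hx y h))
    · exact absurd hxy (ne_of_gt (hlt_card y hy x h))
  · intro x hx y hy hxy
    by_contra hyx
    rw [not_le] at hyx
    exact absurd hxy (not_lt.2 (Finset.card_le_card (hsub x y (Or.inl hyx))))

/-- **KAHN C5 / SAHI `C₃`: ANY INCREASING EVENT AGAINST ANY WEIGHTED-MAJORITY GAME, EVERY PRODUCT MEASURE.**  For `p ∈ [0,1]^ι`, a block `F`,
nonnegative weights `w` on `F`, a quota `θ`, `t : ℕ`, and ANY increasing `F`-determined event `A`:
`0 ≤ E₃(1_{Th_t(F)}, 1_A, 1_{[Σ_{i ∈ F ∩ ω} w_i ≥ θ]})`.  (Rank `F` by increasing weight: the game is right-shifted.) [this work] -/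
theorem sahiE3_threshold_any_weightedMajority_nonneg (p : ι → unitInterval) (F : Finset ι) (t : ℕ) {A : Set (Set ι)} (hA : IsUpperSet A)
    (hAF : DeterminedBy A (↑F : Set ι)) {w : ι → ℝ} (hw : ∀ i ∈ F, 0 ≤ w i) (θ : ℝ) :
    0 ≤ sahiE3 (prodBernoulli p) {ω : Set ι | t ≤ (F.filter (· ∈ ω)).card} A {ω : Set ι | θ ≤ ∑ i ∈ F.filter (· ∈ ω), w i} := by
  obtain ⟨σ, hσ, hmono⟩ := exists_ranking_along F w
  exact sahiE3_threshold_nonneg_of_rightShiftedPartner p σ F hσ t hA (isUpperSet_weightedMajority F hw θ) hAF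
    (determinedBy_weightedMajority F w θ) (tradeClosed_weightedMajority F (R := fun x y => σ x < σ y) hmono θ)


/-! ## Harris-trivial pairs and sandwich pairs -/

/-- **Harris-trivial pairs.**  If `A ∩ B ⊆ H` (every configuration in both events already lies in the first event; for `H = Th_t(F)`: every
`ω ∈ A ∩ B` meets `F` in at least `t` coordinates), then `N(H; 1_A, 1_B) ≥ (μA − μ(H∩A))(μB − μ(H∩B)) ≥ 0` for increasing `A, B` and ANY event
`H`, every `p` (Harris `μ(A∩B) ≥ μA·μB`). [this work] -/
theorem osN_nonneg_of_inter_subset (p : ι → unitInterval) (H : Set (Set ι)) {A B : Set (Set ι)} (hA : IsUpperSet A) (hB : IsUpperSet B)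
    (hABH : A ∩ B ⊆ H) : 0 ≤ osN p H (ind A) (ind B) := by
  have harris : (prodBernoulli p).real A * (prodBernoulli p).real B ≤ (prodBernoulli p).real (A ∩ B) :=
    prodBernoulli_harris p hA hB MeasurableSet.of_discrete MeasurableSet.of_discrete
  have hHAB : (prodBernoulli p).real (H ∩ A ∩ B) = (prodBernoulli p).real (A ∩ B) := by
    congr 1; ext ω; exact ⟨fun h => ⟨h.1.2, h.2⟩, fun h => ⟨⟨hABH h, h.1⟩, h.2⟩⟩
  have hHA : (prodBernoulli p).real (H ∩ A) ≤ (prodBernoulli p).real A := measureReal_mono Set.inter_subset_right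
  have hHB : (prodBernoulli p).real (H ∩ B) ≤ (prodBernoulli p).real B := measureReal_mono Set.inter_subset_right
  have hH1 : (prodBernoulli p).real H ≤ 1 := measureReal_le_one
  rw [osN_ind_ind, hHAB]
  nlinarith [mul_nonneg (sub_nonneg.2 hHA) (sub_nonneg.2 hHB), mul_nonneg (sub_nonneg.2 hH1) (sub_nonneg.2 harris)]

/-- The same in the `E₃` form for a threshold first slot. [this work] -/
theorem sahiE3_threshold_nonneg_of_inter_subset (p : ι → unitInterval) (F : Finset ι) (t : ℕ) {A B : Set (Set ι)} (hA : IsUpperSet A)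
    (hB : IsUpperSet B) (hABH : A ∩ B ⊆ {ω : Set ι | t ≤ (F.filter (· ∈ ω)).card}) :
    0 ≤ sahiE3 (prodBernoulli p) {ω : Set ι | t ≤ (F.filter (· ∈ ω)).card} A B := by
  rw [← osT_ind_ind, osT_eq_osMp_add_osN]
  exact add_nonneg (osMp_threshold_nonneg_all p F t hA hB) (osN_nonneg_of_inter_subset p _ hA hB hABH)

/-- **SANDWICH PAIRS.**  Let `A` be ANY increasing `F`-determined event, `B` any event, and suppose some increasing `F`-determined `V`,
right-shifted w.r.t. an injective ranking of `F`, satisfies `B ⊆ V` and `V ∩ A ∩ Th_t(F) ⊆ B`.  Then `0 ≤ N_t(1_A, 1_B)` for every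
`p ∈ [0,1]^ι`: indeed `N_t(1_A,1_B) − N_t(1_A,1_V) = (μ(HV)−μ(HB))(1−μH)μA + (μ(V∖H)−μ(B∖H))·Cov(1_H,1_A) + (1−μH)(μ(HAB)−μ(HAV)) ≥ 0`
and `N_t(1_A,1_V) ≥ 0` by THEOREM SP. [this work] -/
theorem osN_threshold_nonneg_of_shiftedSandwich (p : ι → unitInterval) (σ : ι → ℕ) (F : Finset ι) (hσ : Set.InjOn σ (↑F : Set ι)) (t : ℕ)
    {A B V : Set (Set ι)} (hA : IsUpperSet A) (hAF : DeterminedBy A (↑F : Set ι)) (hV : IsUpperSet V) (hVF : DeterminedBy V (↑F : Set ι))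
    (hVs : ∀ ω ∈ V, ∀ x ∈ F, ∀ y ∈ F, σ x < σ y → x ∈ ω → y ∉ ω → (ω \ {x}) ∪ {y} ∈ V)
    (hBV : B ⊆ V) (hVB : ∀ ω ∈ V, ω ∈ A → ω ∈ {ω : Set ι | t ≤ (F.filter (· ∈ ω)).card} → ω ∈ B) :
    0 ≤ osN p {ω : Set ι | t ≤ (F.filter (· ∈ ω)).card} (ind A) (ind B) := by
  set H : Set (Set ι) := {ω : Set ι | t ≤ (F.filter (· ∈ ω)).card} with hHdef
  have hSP : 0 ≤ osN p H (ind A) (ind V) := osN_threshold_nonneg_of_rightShiftedPartner p σ F hσ t hA hV hAF hVF hVs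
  have hHup : IsUpperSet H := isUpperSet_threshold F t
  have harris : (prodBernoulli p).real H * (prodBernoulli p).real A ≤ (prodBernoulli p).real (H ∩ A) :=
    prodBernoulli_harris p hHup hA MeasurableSet.of_discrete MeasurableSet.of_discrete
  have hH1 : (prodBernoulli p).real H ≤ 1 := measureReal_le_one
  have hA0 : 0 ≤ (prodBernoulli p).real A := measureReal_nonneg
  have hHB : (prodBernoulli p).real (H ∩ B) ≤ (prodBernoulli p).real (H ∩ V) :=
    measureReal_mono (Set.inter_subset_inter_right _ hBV)
  have hL : (prodBernoulli p).real B - (prodBernoulli p).real (H ∩ B) ≤ (prodBernoulli p).real V - (prodBernoulli p).real (H ∩ V) := by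
    have eB := measureReal_inter_add_sdiff (μ := prodBernoulli p) (s := B) (t := H) MeasurableSet.of_discrete
    have eV := measureReal_inter_add_sdiff (μ := prodBernoulli p) (s := V) (t := H) MeasurableSet.of_discrete
    rw [Set.inter_comm] at eB eV
    have hmono : (prodBernoulli p).real (B \ H) ≤ (prodBernoulli p).real (V \ H) := measureReal_mono (Set.sdiff_subset_sdiff_left hBV)
    linarith
  have hov : (prodBernoulli p).real (H ∩ A ∩ V) ≤ (prodBernoulli p).real (H ∩ A ∩ B) :=
    measureReal_mono fun ω hω => ⟨⟨hω.1.1, hω.1.2⟩, hVB ω hω.2 hω.1.2 hω.1.1⟩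
  have key : osN p H (ind A) (ind B) - osN p H (ind A) (ind V) =
      ((prodBernoulli p).real (H ∩ V) - (prodBernoulli p).real (H ∩ B)) * ((1 - (prodBernoulli p).real H) * (prodBernoulli p).real A)
        + (((prodBernoulli p).real V - (prodBernoulli p).real (H ∩ V)) - ((prodBernoulli p).real B - (prodBernoulli p).real (H ∩ B))) *
            ((prodBernoulli p).real (H ∩ A) - (prodBernoulli p).real H * (prodBernoulli p).real A)
        + (1 - (prodBernoulli p).real H) * ((prodBernoulli p).real (H ∩ A ∩ B) - (prodBernoulli p).real (H ∩ A ∩ V)) := by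
    rw [osN_ind_ind, osN_ind_ind]; ring
  have f1 : 0 ≤ ((prodBernoulli p).real (H ∩ V) - (prodBernoulli p).real (H ∩ B)) * ((1 - (prodBernoulli p).real H) * (prodBernoulli p).real A) :=
    mul_nonneg (sub_nonneg.2 hHB) (mul_nonneg (sub_nonneg.2 hH1) hA0)
  have f2 : 0 ≤ (((prodBernoulli p).real V - (prodBernoulli p).real (H ∩ V)) - ((prodBernoulli p).real B - (prodBernoulli p).real (H ∩ B))) *
      ((prodBernoulli p).real (H ∩ A) - (prodBernoulli p).real H * (prodBernoulli p).real A) :=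
    mul_nonneg (sub_nonneg.2 hL) (sub_nonneg.2 harris)
  have f3 : 0 ≤ (1 - (prodBernoulli p).real H) * ((prodBernoulli p).real (H ∩ A ∩ B) - (prodBernoulli p).real (H ∩ A ∩ V)) :=
    mul_nonneg (sub_nonneg.2 hH1) (sub_nonneg.2 hov)
  linarith

/-- **Kahn C5 / Sahi `C₃` for sandwich pairs** (`A`, `B` increasing `F`-determined; `V` as above): `0 ≤ E₃(1_{Th_t(F)}, 1_A, 1_B)`. [this work] -/
theorem sahiE3_threshold_nonneg_of_shiftedSandwich (p : ι → unitInterval) (σ : ι → ℕ) (F : Finset ι) (hσ : Set.InjOn σ (↑F : Set ι)) (t : ℕ)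
    {A B V : Set (Set ι)} (hA : IsUpperSet A) (hB : IsUpperSet B) (hAF : DeterminedBy A (↑F : Set ι))
    (hV : IsUpperSet V) (hVF : DeterminedBy V (↑F : Set ι))
    (hVs : ∀ ω ∈ V, ∀ x ∈ F, ∀ y ∈ F, σ x < σ y → x ∈ ω → y ∉ ω → (ω \ {x}) ∪ {y} ∈ V)
    (hBV : B ⊆ V) (hVB : ∀ ω ∈ V, ω ∈ A → ω ∈ {ω : Set ι | t ≤ (F.filter (· ∈ ω)).card} → ω ∈ B) :
    0 ≤ sahiE3 (prodBernoulli p) {ω : Set ι | t ≤ (F.filter (· ∈ ω)).card} A B := by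
  rw [← osT_ind_ind, osT_eq_osMp_add_osN]
  exact add_nonneg (osMp_threshold_nonneg_all p F t hA hB) (osN_threshold_nonneg_of_shiftedSandwich p σ F hσ t hA hAF hV hVF hVs hBV hVB)

end SahiOneStep

end Summit.CriticalPhenomena.PercolationContinuityZ3.Theorems
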